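import Summits.BirchSwinnertonDyer.BirchSwinnertonDyer.Theses.ByReductionTypeAtTwo
import Summits.BirchSwinnertonDyer.BirchSwinnertonDyer.Theorems.ByReductionTypeAtTwoMultiplicativeInputs
import Summits.BirchSwinnertonDyer.Rank1Residual.X5.TwoAdicTargetsMultEisensteinLower
import HarnessLib

/-!
# Route `ByReductionTypeAtTwo`, layer-2 child `MultLowerHalfAtTwo` (item stmt-BirchSwinnertonDyer-19923):
# Theorems-side BRIDGES typing the object of the lower half at a multiplicative `2` (nothing asserted)

The item is `∀ non-CM W, r_an = 0 → Mult W 2 → Typed.MissingLowerBoundAt W 2` (`ord₂ #Ш_an ≤ ord₂ #Ш`):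
the Eisenstein / Skinner–Urban direction `L₂ ∣ char_Λ X` of the cyclotomic main conjecture at a
MULTIPLICATIVE `2`, which is NOT in print at `p = 2` (Skinner 2016 Thm. A/B `p ≥ 3`; Skinner–Urban 2014
`p` odd, `p ∤ N`; every later Eisenstein-congruence main conjecture keeps `p` odd). Three kernel
certificates, each stated against the REGISTERED route constant
`Summit.BirchSwinnertonDyer.BirchSwinnertonDyer.Theses.ByReductionTypeAtTwo.MultLowerHalfAtTwo`:

* `multLowerHalfAtTwo_of_multEisenstein` — **the item reduces to ONE ∀-closed typed research object**,
  T-mult-4-int `X5.O1.MultEisensteinDivisibilityAtTwo W` (the integral, Néron-normalised Eisenstein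
  divisibility at a multiplicative `2`, both signs; `X5/TwoAdicTargetsMultEisenstein.lean`), modulo
  PRINT {Greenberg's Thm-4.1 analogues at a non-split / split multiplicative prime (A235
  `thm41Analogue_charValue_rankZero_numberField_anyPrime`, A236
  `thm41Analogue_charValue_rankZero_split_baseChange_anyPrime`), modularity
  (`nonempty_modularParametrizationData`), GZK (`rank_eq_analyticRank_of_analyticRank_le_one`)} + the
  cell's two memo-proved binders {Kato `⊗ℚ` at a multiplicative `2` (`hKato`,
  `X5.O1.KatoMultiplicativeDivisibilityRat W 2`, HOME mult/PROOF-MULT.md, referee RC-2 PASS — only its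
  clause (1) «`X(E/ℚ_∞)` is `Λ`-torsion» is used), the Greenberg–Stevens formula at a split `2` (`hGS`,
  `greenberg_stevens W 2`, HOME mult/PROOF-GS2.md, RC-4 PASS)} — the SAME displayed binders as the
  parent's `μ = 0` road `multiplicativeRankZeroAtTwo_of_muRoad` (p409679). The per-pair work is the
  proved chain `X5.O1.missingLowerBoundAt_two_of_multEisenstein_of_greenberg_of_multRat`
  (`X5/TwoAdicTargetsMultEisensteinLower.lean`).
* `multLowerHalfAtTwo_of_multiplicativeRankZeroAtTwo` — child ⟸ parent (GZK for `Ш` finite): the split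
  `MultiplicativeRankZeroAtTwo ⇐ halves` is an equivalence of ∀-statements, so the child is not weaker
  than needed and not stronger than the crux.
* `multiplicativeRankZeroAtTwo_of_muRoad_of_multEisenstein` — the parent's `μ = 0` road with its raw
  binder `hlow` DISCHARGED by T-mult-4-int: on that road the open class-wide inputs of the crux
  `MultiplicativeRankZeroAtTwo` are exactly THREE typed objects {`μ(X(E/ℚ_∞)) = 0`, the period
  integrality `0 ≤ ord₂ ϖ`, T-mult-4-int} over PRINT + MEMO — no untyped binder remains.

HONEST FRAMING (cell bsd-2adic, seat bsd-2adic-mult-3, D-0074 (A) «find: 19923»): COMPOSITION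
certificates; every research input stays a hypothesis; the item is NOT closed (T-mult-4-int is OPEN);
no class is closed here; BSD is not proved by any of this. PARTITION: X5@2 mult (K4ᵐ, RESIDUAL-MAP
B1·O1; 1 976 book230 classes) × p = 2 — types-the-object-of (item 19923); closes none.
[cite: Miller2011LMS, Def 1.1] [cite: GreenbergLNM1716, §4 pp. 112–113]
[cite: Skinner2016PacificMC, Thm. A/B (§1; p ≥ 3; shape)] [cite: SkinnerUrban2014, Thm. 3.6.4 (p. 43; shape)]
-/

set_option autoImplicit false
-- the route's Theorems namespace `Summit.BirchSwinnertonDyer.BirchSwinnertonDyer.Theorems` repeats a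
-- component by design (summit = sub-problem, D-0017); same justification as p409679.
set_option linter.dupNamespace false

noncomputable section

open scoped Classical MatrixGroups ModularForm

open CongruenceSubgroup WeierstrassCurve Literature.NumberTheory.EllipticCurves
  Literature.NumberTheory.EllipticCurves.ModularForms
  Literature.NumberTheory.EllipticCurves.Greenberg1999
  Literature.NumberTheory.EllipticCurves.Rank1Residual
  Literature.NumberTheory.EllipticCurves.Rank1Residual.Typed
  Summit.BirchSwinnertonDyer.Rank1Residual.X5

namespace Summit.BirchSwinnertonDyer.BirchSwinnertonDyer.Theorems

/-- **Bridge (T-mult-4-int ⇒ the lower half, item 19923).** PRINT {Greenberg's Thm-4.1 analogues at a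
non-split / split multiplicative prime (`h41ns`, `h41sp`), modularity (`hmod`), GZK (`hGZK`)} + MEMO
{Kato `⊗ℚ` at a multiplicative `2` (`hKato`; only `X` torsion is used), Greenberg–Stevens at a split `2`
(`hGS`)} + the ONE research object T-mult-4-int ∀-closed over non-CM `E/ℚ` of analytic rank `0`
multiplicative at `2` (`hE`) imply the route's child `MultLowerHalfAtTwo`
(`∀ …, Typed.MissingLowerBoundAt W 2`), by `X5.O1.missingLowerBoundAt_two_of_multEisenstein_of_greenberg_of_multRat`
per pair. Composition certificate; nothing asserted; the item stays OPEN with T-mult-4-int.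
[cite: GreenbergLNM1716, §4 pp. 112–113] [cite: Miller2011LMS, Def 1.1] -/
theorem multLowerHalfAtTwo_of_multEisenstein
    (h41ns : thm41Analogue_charValue_rankZero_numberField_anyPrime)
    (h41sp : thm41Analogue_charValue_rankZero_split_baseChange_anyPrime)
    (hmod : nonempty_modularParametrizationData)
    (hGZK : rank_eq_analyticRank_of_analyticRank_le_one)
    (hKato : ∀ (W : WeierstrassCurve ℚ) [W.IsElliptic] [W.IsGloballyMinimal],
      ¬ W.HasCM → Mult W 2 → O1.KatoMultiplicativeDivisibilityRat W 2)
    (hGS : ∀ (W : WeierstrassCurve ℚ) [W.IsElliptic] [W.IsGloballyMinimal],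
      W.HasSplitMultiplicativeReductionAtPrime 2 → greenberg_stevens (W := W) (p := 2))
    (hE : ∀ (W : WeierstrassCurve ℚ) [W.IsElliptic] [W.IsGloballyMinimal],
      ¬ W.HasCM → W.analyticRank = 0 → Mult W 2 → O1.MultEisensteinDivisibilityAtTwo W) :
    Summit.BirchSwinnertonDyer.BirchSwinnertonDyer.Theses.ByReductionTypeAtTwo.MultLowerHalfAtTwo := by
  unfold Summit.BirchSwinnertonDyer.BirchSwinnertonDyer.Theses.ByReductionTypeAtTwo.MultLowerHalfAtTwo
  intro W _ _ hcm hr hmult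
  exact O1.missingLowerBoundAt_two_of_multEisenstein_of_greenberg_of_multRat W h41ns h41sp hmod hGZK
    (hKato W hcm hmult) (hGS W) hr hmult (hE W hcm hr hmult)

/-- **Bridge (parent ⇒ child).** The crux `MultiplicativeRankZeroAtTwo` (`BSD(E,2)` on the class) gives
back the lower half `MultLowerHalfAtTwo`, granted GZK (`Ш` finite at analytic rank `0`, so that
`ord₂ #Ш(2) = ord₂ #Ш`: `missingPPartAt_of_bsdp`, then `lower_and_upper_of_missingPPartAt`). With
`multiplicativeRankZeroAtTwo_of_halves` (p409679) the glued split of item 19096 is an EQUIVALENCE of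
∀-statements modulo GZK. Bookkeeping; nothing asserted. [cite: Miller2011LMS, Def 1.1] -/
theorem multLowerHalfAtTwo_of_multiplicativeRankZeroAtTwo
    (hGZK : rank_eq_analyticRank_of_analyticRank_le_one)
    (h : Summit.BirchSwinnertonDyer.BirchSwinnertonDyer.Theses.ByReductionTypeAtTwo.MultiplicativeRankZeroAtTwo) :
    Summit.BirchSwinnertonDyer.BirchSwinnertonDyer.Theses.ByReductionTypeAtTwo.MultLowerHalfAtTwo := by
  unfold Summit.BirchSwinnertonDyer.BirchSwinnertonDyer.Theses.ByReductionTypeAtTwo.MultLowerHalfAtTwo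
  intro W _ _ hcm hr hmult
  have hbsd : BSDp W 2 := h W hcm hr hmult
  haveI : Finite W.sha := (hGZK W (by omega)).2
  exact (lower_and_upper_of_missingPPartAt W 2 (missingPPartAt_of_bsdp W 2 hbsd)).1

/-- **Bridge (the `μ = 0` road with `hlow` DISCHARGED by T-mult-4-int ⇒ crux).** The parent's road
`multiplicativeRankZeroAtTwo_of_muRoad` (p409679) consumes, ∀-closed over the class, PRINT {`h41ns`,
`h41sp`, `hmod`, `hGZK`} + MEMO {`hKato`, `hGS`} + the OPEN objects {`hμ` : `μ(X(E/ℚ_∞)) = 0` for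
every cyclotomic dual datum, `hper₀` : `0 ≤ ord₂ ϖ` for the newform's Néron period ratio, `hlow` :
the lower half}. Here `hlow` is replaced by T-mult-4-int (`hE`) through
`multLowerHalfAtTwo_of_multEisenstein`: on this road the crux `MultiplicativeRankZeroAtTwo` has
exactly three typed class-wide research inputs {`μ = 0`, `0 ≤ ord₂ ϖ`, T-mult-4-int} and no untyped
binder. Composition certificate; nothing asserted. [cite: Kato2004Asterisque, Thm 17.4 and 17.13 (shape)]
[cite: GreenbergLNM1716, §4 pp. 112–113] [cite: Miller2011LMS, Def 1.1] -/
theorem multiplicativeRankZeroAtTwo_of_muRoad_of_multEisenstein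
    (hKato : ∀ (W : WeierstrassCurve ℚ) [W.IsElliptic] [W.IsGloballyMinimal],
      ¬ W.HasCM → Mult W 2 → O1.KatoMultiplicativeDivisibilityRat W 2)
    (h41ns : thm41Analogue_charValue_rankZero_numberField_anyPrime)
    (h41sp : thm41Analogue_charValue_rankZero_split_baseChange_anyPrime)
    (hmod : nonempty_modularParametrizationData)
    (hGZK : rank_eq_analyticRank_of_analyticRank_le_one)
    (hGS : ∀ (W : WeierstrassCurve ℚ) [W.IsElliptic] [W.IsGloballyMinimal],
      W.HasSplitMultiplicativeReductionAtPrime 2 → greenberg_stevens (W := W) (p := 2))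
    (hμ : ∀ (W : WeierstrassCurve ℚ) [W.IsElliptic] [W.IsGloballyMinimal],
      ¬ W.HasCM → W.analyticRank = 0 → Mult W 2 →
      ∀ (κ : ZpExtension ℚ 2) (γ : Field.absoluteGaloisGroup ℚ), κ.IsCyclotomic →
        κ.IsTopGenerator γ → IsCyclotomicVariable 2 γ → ∀ D : W.SelmerDualData κ γ, D.mu = 0)
    (hper₀ : ∀ (W : WeierstrassCurve ℚ) [W.IsElliptic] [W.IsGloballyMinimal],
      ¬ W.HasCM → W.analyticRank = 0 → Mult W 2 →
      ∀ [NeZero (W.conductorNorm ℤ)] (f : CuspForm (Gamma0 (W.conductorNorm ℤ)) 2),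
        IsNewformOf W f → ∀ ϖ : ℚ, (ϖ : ℝ) * W.realPeriodRat = plusPeriod f → 0 ≤ padicValRat 2 ϖ)
    (hE : ∀ (W : WeierstrassCurve ℚ) [W.IsElliptic] [W.IsGloballyMinimal],
      ¬ W.HasCM → W.analyticRank = 0 → Mult W 2 → O1.MultEisensteinDivisibilityAtTwo W) :
    Summit.BirchSwinnertonDyer.BirchSwinnertonDyer.Theses.ByReductionTypeAtTwo.MultiplicativeRankZeroAtTwo := by
  have hlow := multLowerHalfAtTwo_of_multEisenstein h41ns h41sp hmod hGZK hKato hGS hE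
  unfold Summit.BirchSwinnertonDyer.BirchSwinnertonDyer.Theses.ByReductionTypeAtTwo.MultLowerHalfAtTwo
    at hlow
  exact multiplicativeRankZeroAtTwo_of_muRoad hKato h41ns h41sp hmod hGZK hGS hμ hper₀ hlow

end Summit.BirchSwinnertonDyer.BirchSwinnertonDyer.Theorems

end
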